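import Summits.BirchSwinnertonDyer.BirchSwinnertonDyer.Theorems.ByReductionTypeAtTwoProp514Kernel
import Summits.BirchSwinnertonDyer.BirchSwinnertonDyer.Theses.ByReductionTypeAtTwo
import HarnessLib

/-!
# Route ByReductionTypeAtTwo (K4): the aside `AsideGreenbergProp514AtTwo` closed BY NAME

Seat `bsd-2adic-t42` (HOME `run/shared/lean/pub/bsd-2adic/`). HONEST FRAMING (cell bsd-2adic): BSD is not proved by
any of this. This file closes only the route ASIDE item stmt-BirchSwinnertonDyer-23878, whose text is literally the
Literature named fact `Greenberg1999.prop514_isTorsion_mu_eq_zero_two` (Greenberg, LNM 1716, Prop. 5.14 at `p = 2`: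
`E/ℚ` good ordinary or multiplicative at `2` with a rational `2`-torsion point `P` such that `⟨P⟩` is ramified-at-`2`
XOR odd ⇒ `Sel(E/ℚ_∞)₂` is `Λ`-cotorsion with `μ_E = 0`). That fact is now a KERNEL theorem,
`Prop514AtTwo.prop514_isTorsion_mu_eq_zero_two_holds` (module `…Theorems.ByReductionTypeAtTwoProp514Kernel`), and the
aside is that theorem, applied once. Consumers of the re-cut print bundle `OrdKatoIsoPrintBundleAtTwo`
(stmt-BirchSwinnertonDyer-23889) feed its third conjunct by the same name.
-/

set_option linter.dupNamespace false

namespace Summit.BirchSwinnertonDyer.BirchSwinnertonDyer.Theorems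

open Summit.BirchSwinnertonDyer.BirchSwinnertonDyer.Theses.ByReductionTypeAtTwo

/-- **K4 aside `AsideGreenbergProp514AtTwo` (route `ByReductionTypeAtTwo`, item stmt-BirchSwinnertonDyer-23878),
proved by name:** Greenberg, LNM 1716, Prop. 5.14 at `p = 2` — for `E/ℚ` globally minimal with good ordinary or
multiplicative reduction at `2` and a rational point of order `2` generating a line that is «ramified at `2` and not
odd» or «odd and not ramified at `2`», every cyclotomic Selmer dual datum is `Λ`-torsion with `μ = 0` — is the kernel
theorem `Prop514AtTwo.prop514_isTorsion_mu_eq_zero_two_holds`. Nothing about BSD or the crux 202 is asserted.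
[cite: GreenbergLNM1716, §5 Prop. 5.14 (p. 122)] -/
theorem asideGreenbergProp514AtTwo_proof : AsideGreenbergProp514AtTwo :=
  Prop514AtTwo.prop514_isTorsion_mu_eq_zero_two_holds

end Summit.BirchSwinnertonDyer.BirchSwinnertonDyer.Theorems
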